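import Summits.RiemannHypothesis.RiemannHypothesis.Theorems.SoloInformedZeroSideWindow
import Literature.NumberTheory.LFunctions.WeilDilationVirial
import Literature.NumberTheory.LFunctions.WeilLineSupSamplingPrelim
import HarnessLib

/-!
# T72d — the rigidity probe (solo-informed, rigidity line R2a)

Fourth file of the local pair-correlation rigidity line (sharpest statement §2k (xi), plan T72).
The probe at scale `b > 0` centred at height `t` is the modulated unitary dilate
`f_{b,t}(x) = e^{-itx} b^{-1/2} Φ(x/b)` of a fixed test `Φ`, written with the tree's
`weilDilate` (`η = b⁻¹ - 1`) and the modulation of `WeilLineSupSamplingPrelim`: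

* `isWeilTest_probe`, `tsupport_probe_subset` (`supp ⊆ [-ab, ab]` if `supp Φ ⊆ [-a, a]`),
  `integral_norm_sq_probe` (`‖f_{b,t}‖₂ = ‖Φ‖₂`);
* `weilMellin_probe`, `weilMellin_probe_half`, `norm_sq_weilMellin_probe_half` — the transform is
  `f̂_{b,t}(s) = b^{1/2} Φ̂(1/2 + b(s - 1/2 - it))`, on the critical line
  `|f̂_{b,t}(1/2 + iγ)|² = b |Φ̂(1/2 + i b(γ - t))|²`: a bump of height `≍ b` and width `≍ 1/b`
  around the ordinate `t`;
* `mul_le_norm_sq_weilMellin_probe` — if `|Φ̂(1/2 + iu)|² ≥ μ` for `|u| ≤ 2` then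
  `|f̂_{b,t}(1/2 + iγ)|² ≥ bμ` for `|γ - t| ≤ 2/b`;
* `probe_zetaZeroCount_le_re_weilQuadratic` — **under RH**, for `0 ≤ T₁ ≤ T₂` inside
  `[t - 2/b, t + 2/b]`: `bμ · (N(T₂) − N(T₁)) ≤ Re Q(f_{b,t})` (zeros counted with multiplicity,
  via T72b `mul_zetaZeroCount_sub_le_re_weilQuadratic_of_line`).

This is hypothesis `hZ` of the covering step T72c (`mul_sq_mass_le_card_mul_integral_sq`) with
`Z(t) = Re Q(f_{b,t})`.

References: H. L. Montgomery, *The pair correlation of zeros of the zeta function*, Proc. Symp.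
Pure Math. 24 (1973) 181–193 (test functions concentrated at scale `1/log T`); E. Bombieri,
*Remarks on Weil's quadratic functional in the theory of prime numbers I*, Rend. Mat. Acc. Lincei
(9) 11 (2000), §4 (the unitary dilation; key `Bombieri2000Weil`).
-/

noncomputable section

open Complex Filter Set Topology MeasureTheory
open Literature.NumberTheory.LFunctions
open scoped Real

namespace Summit.RiemannHypothesis.RiemannHypothesis.Theorems

/-- `η = b⁻¹ - 1 > -1` for `b > 0` (admissibility of the dilation parameter). -/
theorem neg_one_lt_inv_sub_one {b : ℝ} (hb : 0 < b) : -1 < b⁻¹ - 1 := by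
  have := inv_pos.2 hb
  linarith

/-- The probe is a Weil test function. -/
theorem isWeilTest_probe {Φ : ℝ → ℂ} (hΦ : IsWeilTest Φ) {b : ℝ} (hb : 0 < b) (t : ℝ) :
    IsWeilTest fun x ↦ weilDilate (b⁻¹ - 1) Φ x * cexp (((-t) * x : ℝ) * I) :=
  isWeilTest_mul_cexp_ofReal_mul_I (hΦ.weilDilate (neg_one_lt_inv_sub_one hb)) (-t)

/-- Support of the probe: `supp Φ ⊆ [-a, a]` gives `supp f_{b,t} ⊆ [-ab, ab]`. -/
theorem tsupport_probe_subset (Φ : ℝ → ℂ) {b : ℝ} (hb : 0 < b) {a : ℝ}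
    (h : tsupport Φ ⊆ Icc (-a) a) (t : ℝ) :
    tsupport (fun x ↦ weilDilate (b⁻¹ - 1) Φ x * cexp (((-t) * x : ℝ) * I)) ⊆
      Icc (-(a * b)) (a * b) := by
  refine (tsupport_mul_cexp_subset _ (-t)).trans ?_
  have h1 := tsupport_weilDilate_subset Φ (neg_one_lt_inv_sub_one hb) h
  have h2 : (1 : ℝ) + (b⁻¹ - 1) = b⁻¹ := by ring
  rwa [h2, div_inv_eq_mul] at h1

/-- The probe has the `L²` norm of `Φ`. -/
theorem integral_norm_sq_probe (Φ : ℝ → ℂ) {b : ℝ} (hb : 0 < b) (t : ℝ) :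
    ∫ x : ℝ, ‖weilDilate (b⁻¹ - 1) Φ x * cexp (((-t) * x : ℝ) * I)‖ ^ 2 =
      ∫ x : ℝ, ‖Φ x‖ ^ 2 := by
  have h : ∀ x : ℝ, ‖weilDilate (b⁻¹ - 1) Φ x * cexp (((-t) * x : ℝ) * I)‖ =
      ‖weilDilate (b⁻¹ - 1) Φ x‖ := fun x ↦ by
    rw [norm_mul, Complex.norm_exp_ofReal_mul_I, mul_one]
  simp_rw [h]
  exact integral_norm_sq_weilDilate Φ (neg_one_lt_inv_sub_one hb)

/-- Transform of the probe: `f̂_{b,t}(s) = b^{-1/2} · b · Φ̂(1/2 + b (s - 1/2 - it))`. -/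
theorem weilMellin_probe (Φ : ℝ → ℂ) {b : ℝ} (hb : 0 < b) (t : ℝ) (s : ℂ) :
    weilMellin (fun x ↦ weilDilate (b⁻¹ - 1) Φ x * cexp (((-t) * x : ℝ) * I)) s =
      (Real.sqrt b⁻¹ : ℂ) * (b : ℂ) *
        weilMellin Φ (1 / 2 + (b : ℂ) * (s - 1 / 2 - (t : ℂ) * I)) := by
  have hb0 : (b : ℂ) ≠ 0 := ofReal_ne_zero.2 hb.ne'
  rw [weilMellin_mul_cexp_ofReal_mul_I, weilMellin_weilDilate Φ (neg_one_lt_inv_sub_one hb)]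
  have h2 : (1 : ℝ) + (b⁻¹ - 1) = b⁻¹ := by ring
  rw [h2]
  congr 1
  · push_cast
    rw [inv_inv]
  · congr 1
    push_cast
    field_simp
    ring

/-- On the critical line: `f̂_{b,t}(1/2 + iγ) = b^{-1/2} · b · Φ̂(1/2 + i b(γ - t))`. -/
theorem weilMellin_probe_half (Φ : ℝ → ℂ) {b : ℝ} (hb : 0 < b) (t γ : ℝ) :
    weilMellin (fun x ↦ weilDilate (b⁻¹ - 1) Φ x * cexp (((-t) * x : ℝ) * I)) (1 / 2 + γ * I) =
      (Real.sqrt b⁻¹ : ℂ) * (b : ℂ) *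
        weilMellin Φ (1 / 2 + ((b * (γ - t) : ℝ) : ℂ) * I) := by
  rw [weilMellin_probe Φ hb]
  congr 2
  push_cast
  ring

/-- `|f̂_{b,t}(1/2 + iγ)|² = b |Φ̂(1/2 + i b(γ - t))|²`. -/
theorem norm_sq_weilMellin_probe_half (Φ : ℝ → ℂ) {b : ℝ} (hb : 0 < b) (t γ : ℝ) :
    ‖weilMellin (fun x ↦ weilDilate (b⁻¹ - 1) Φ x * cexp (((-t) * x : ℝ) * I))
        (1 / 2 + γ * I)‖ ^ 2 =
      b * ‖weilMellin Φ (1 / 2 + ((b * (γ - t) : ℝ) : ℂ) * I)‖ ^ 2 := by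
  rw [weilMellin_probe_half Φ hb, norm_mul, norm_mul, mul_pow, mul_pow, Complex.norm_real,
    Complex.norm_real, Real.norm_of_nonneg (Real.sqrt_nonneg _), Real.norm_of_nonneg hb.le,
    Real.sq_sqrt (inv_pos.2 hb).le]
  congr 1
  field_simp

/-- Lower bound on the bump: if `|Φ̂(1/2 + iu)|² ≥ μ` for `|u| ≤ 2` then
`|f̂_{b,t}(1/2 + iγ)|² ≥ bμ` whenever `|γ - t| ≤ 2/b`. -/
theorem mul_le_norm_sq_weilMellin_probe (Φ : ℝ → ℂ) {b : ℝ} (hb : 0 < b) {μ : ℝ}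
    (hμ : ∀ u : ℝ, |u| ≤ 2 → μ ≤ ‖weilMellin Φ (1 / 2 + u * I)‖ ^ 2) {t γ : ℝ}
    (hγ : |γ - t| ≤ 2 / b) :
    b * μ ≤ ‖weilMellin (fun x ↦ weilDilate (b⁻¹ - 1) Φ x * cexp (((-t) * x : ℝ) * I))
        (1 / 2 + γ * I)‖ ^ 2 := by
  rw [norm_sq_weilMellin_probe_half Φ hb]
  refine mul_le_mul_of_nonneg_left (hμ _ ?_) hb.le
  rw [abs_mul, abs_of_pos hb]
  calc b * |γ - t| ≤ b * (2 / b) := mul_le_mul_of_nonneg_left hγ hb.le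
    _ = 2 := by field_simp

/-- **The probe sees the local zero count (RH).** If `|Φ̂(1/2 + iu)|² ≥ μ` on `|u| ≤ 2`, then for
`0 ≤ T₁ ≤ T₂` with `[T₁, T₂] ⊆ [t - 2/b, t + 2/b]`,
`bμ · (N(T₂) − N(T₁)) ≤ Re Q(f_{b,t})` (zeros with multiplicity). -/
theorem probe_zetaZeroCount_le_re_weilQuadratic (hRH : _root_.RiemannHypothesis) {Φ : ℝ → ℂ}
    (hΦ : IsWeilTest Φ) {b : ℝ} (hb : 0 < b) {μ : ℝ}
    (hμ : ∀ u : ℝ, |u| ≤ 2 → μ ≤ ‖weilMellin Φ (1 / 2 + u * I)‖ ^ 2) {t T₁ T₂ : ℝ}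
    (h0 : 0 ≤ T₁) (h12 : T₁ ≤ T₂) (h1 : t - 2 / b ≤ T₁) (h2 : T₂ ≤ t + 2 / b) :
    b * μ * ((zetaZeroCount T₂ : ℝ) - zetaZeroCount T₁) ≤
      (weilQuadratic fun x ↦ weilDilate (b⁻¹ - 1) Φ x * cexp (((-t) * x : ℝ) * I)).re :=
  mul_zetaZeroCount_sub_le_re_weilQuadratic_of_line hRH (isWeilTest_probe hΦ hb t) h0 h12
    fun γ hγ1 hγ2 ↦ mul_le_norm_sq_weilMellin_probe Φ hb hμ
      (abs_le.2 ⟨by linarith, by linarith⟩)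

end Summit.RiemannHypothesis.RiemannHypothesis.Theorems

end
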